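import Literature.NumberTheory.LFunctions.RodgersTaoGapBoundProofs
import Mathlib.Analysis.PSeries
import HarnessLib

/-!
# Rodgers–Tao 2020, proof of Proposition 15 (FMP pp. 38–39): far-field inputs for the S4 assembly
# of the P6.1 content twin — uniform TAILS `Σ_{j ∈ ℤ*} x_j(t)⁻² ≤ C_T` and the per-`k` FAR FIELD `O(1)`

RH-FREE literature PROOFS (no definitions, no named facts, no `sorry`). Trunk T-ANT
(`Literature/NumberTheory/LFunctions`); stages S4a (TAILS) and S4b′ (FAR FIELD per `k`) of the C3
cell's programme «P6.1 CONTENT twin» (rt-lead rulings (46)(c), (55)(c), (56)(a), rt/STATUS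
2026-08-26), i.e. the separable far-field inputs of rt-t4's S4 ARCHITECTURE v2/v3 (rt/STATUS
2026-08-26T11:43:30Z and 12:21:30Z — the frozen signature of `exists_far_interactionEnergy_sum_le`;
ERRATA E13 «FAR reduction») for the content twin `rodgers_tao_weak_energy_bound_of` of the typed,
VACUOUS-AS-PRINTED fact `Literature.NumberTheory.LFunctions.rodgers_tao_weak_energy_bound`:

> B. Rodgers, T. Tao, *The de Bruijn–Newman constant is non-negative*, Forum Math. Pi 8 (2020)
> e6 (= arXiv:1801.05914v5), **Prop. 15** (p. 38) and its proof (p. 39): "Using `ab ≪ a² + b²`,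
> we thus have `Q_K ≪ J² log^{O(1)} J + ∫_{Λ/2}^{0} Σ_{j ∉ K, k ∈ K} 1/|x_j(t) − x_k(t)|² dt`.
> The contribution of those `j` with `j > 3J` or `j < J/4` can be easily handled using
> Theorem 11 and (50), leading to a net contribution of `O(J² log^{O(1)} J)` for this portion
> of the sum."

House form (cell ruling R2): the printed time range `Λ/2 ≤ t ≤ 0` is an arbitrary compact
interval `[t₁, t₂]` above a real-rooted time `t₀ < t₁`; nothing is asserted at `t ≤ 0 ≤ Λ`.

## Main results (all `theorem`s, 0 new facts)

* `inv_sq_le_div_sq_add_one_of_le` — the elementary comparison `x⁻² ≤ (1 + g⁻²)/(x² + 1)` for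
  `0 < g ≤ x`;
* `exists_tsum_inv_deBruijnZero_sq_le` — **TAILS, `ℕ`-indexed**: there is `C ≥ 0` with
  `Σ_{n ≥ 1} x_n(t)⁻²` summable and `≤ C` for every `t ∈ [t₁, t₂]`;
* `exists_tsum_inv_deBruijnZeroZ_sq_le` — **TAILS over `ℤ`** (`x_0 = 0` contributes `0⁻¹ = 0`,
  so the `ℤ`-sum is the `ℤ*`-sum): `Σ_{j ∈ ℤ} x_j(t)⁻²` summable and `≤ C` uniformly on `[t₁, t₂]`,
  together with the same bound for the sum over any index set `s ⊆ ℤ` (subtype `tsum`,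
  `exists_tsum_subtype_inv_deBruijnZeroZ_sq_le`);
* `exists_far_interactionEnergy_sum_le` — **FAR FIELD per `k` is `O(1)`** (rt-t4's frozen S4b′
  signature): given the location law H2 (eq. (50)) uniformly on `[t₁, t₂]`, there are `C ≥ 0`,
  `D ≥ 1` such that for all `t ∈ [t₁, t₂]`, `2 ≤ k ≤ M`, `L ≥ D log₊² M` and every finite
  `S ⊂ ℤ*` at index distance `≥ L` from `k`: `Σ_{j ∈ S} E_{jk}(t) ≤ C`.

Proof routes (differ from print only in bookkeeping). TAILS: instead of Theorem 11 + (50)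
termwise, the uniform bound comes from the Hadamard series
`Σ_{n ≥ 1} 1/(x_n(t)² + 1) = Re((i/2)H_t'(i)/H_t(i))` (`hasSum_inv_deBruijnZero_sq_add_one`),
bounded on `[t₁, t₂]` by compactness (`exists_bound_logDeriv_I`), and the uniform floor
`x_n(t) ≥ x_1(t) ≥ g₀ > 0` (`exists_uniform_gap_lower` with `x_0 = 0`), via
`x⁻² ≤ (1 + g₀⁻²)/(x² + 1)`. FAR FIELD: the index set splits into `j > k`, `1 ≤ j < k`, `j ≤ −1`;
the first two use the pointwise far-field bounds `interactionEnergy_far_right` /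
`interactionEnergy_far_left` of `RodgersTaoGapBoundProofs.lean` (§A there:
`E_{jk} ≤ (32C₁²/c₂²)(log₊² k + log₊² i)/i²`, `i = |j − k| ≥ L`, whose thresholds
`2D′ log₊² k`, `4096 D′²` are absorbed by `D = 3(1 + 2D′ + 4096D′²)`, `D′ = 16 max(B,0) C₁²/c₂`,
using `log₊ ≥ log 2`), summed with `Σ_{i ≥ L} log₊² M/i² ≤ 2 log₊² M/L ≤ 2` and
`Σ log₊² i/i² ≤ S₀`; the negative indices use `sum_interactionEnergy_neg_le` with the uniform
floor `x_2 − x_1 ≥ g₀` on `[t₁, t₂]`.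

LABEL: RH-FREE CONTENT (0 facts). bears_on: N-C/N-P (COLUMN 3 DBN).
WHAT THIS IS NOT: bookkeeping for Rodgers–Tao's RH-free integrated-energy bound at times above a
real-rooted time (its printed `[Λ/2, 0]` instance is VACUOUS-AS-PRINTED); nothing here bears on the
truth of RH.

## References

* B. Rodgers, T. Tao, Forum Math. Pi 8 (2020) e6, Prop. 15 pp. 38–39, Thm. 11 p. 27, Cor. 10
  (50) p. 23 (= arXiv:1801.05914v5 Prop. 6.1, Thm. 4.1, Cor. 3.3).
-/

noncomputable section

open Set Filter Topology

namespace Literature.NumberTheory.LFunctions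

/-! ## The elementary comparison -/

/-- For `0 < g ≤ x`: `x⁻² ≤ (1 + g⁻²)/(x² + 1)` (since `(x² + 1)/x² = 1 + x⁻² ≤ 1 + g⁻²`).
[cite: RodgersTaoFMP2020, §6 proof of Prop. 15, FMP p. 39 (the portion j > 3J or j < J/4)] -/
theorem inv_sq_le_div_sq_add_one_of_le {g x : ℝ} (hg : 0 < g) (hx : g ≤ x) :
    (x ^ 2)⁻¹ ≤ (1 + (g ^ 2)⁻¹) / (x ^ 2 + 1) := by
  have hx0 : 0 < x := hg.trans_le hx
  have hx2 : 0 < x ^ 2 := by positivity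
  have hg2 : 0 < g ^ 2 := by positivity
  have hgx : g ^ 2 ≤ x ^ 2 := pow_le_pow_left₀ hg.le hx 2
  rw [inv_eq_one_div, div_le_div_iff₀ hx2 (by positivity)]
  have h1 : (x ^ 2)⁻¹ ≤ (g ^ 2)⁻¹ := inv_anti₀ hg2 hgx
  have h2 : x ^ 2 * (x ^ 2)⁻¹ = 1 := mul_inv_cancel₀ hx2.ne'
  nlinarith [mul_le_mul_of_nonneg_left h1 hx2.le]

/-! ## TAILS, `ℕ`-indexed -/

/-- **Uniform TAILS bound, `ℕ`-indexed**: on a compact time interval `[t₁, t₂]` above a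
real-rooted time `t₀ < t₁` there is `C ≥ 0` such that for every `t ∈ [t₁, t₂]` the series
`Σ_{n ≥ 0} x_{n+1}(t)⁻²` converges and is `≤ C`.
[cite: RodgersTaoFMP2020, §6 proof of Prop. 15, FMP p. 39 (the portion j > 3J or j < J/4, «using Theorem 11 and (50)»)] -/
theorem exists_tsum_inv_deBruijnZero_sq_le {t₀ t₁ t₂ : ℝ}
    (hreal : HasOnlyRealZeros (deBruijnH t₀)) (ht₀ : t₀ < t₁) :
    ∃ C : ℝ, 0 ≤ C ∧ ∀ t ∈ Icc t₁ t₂,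
      Summable (fun n : ℕ ↦ (deBruijnZero t (n + 1) ^ 2)⁻¹) ∧
      ∑' n : ℕ, (deBruijnZero t (n + 1) ^ 2)⁻¹ ≤ C := by
  obtain ⟨A, hA1, hA⟩ := exists_bound_logDeriv_I (t₂ := t₂) hreal ht₀
  obtain ⟨g₀, hg₀, hgap⟩ := exists_uniform_gap_lower (t₂ := t₂) ht₀ hreal 0
  refine ⟨(1 + (g₀ ^ 2)⁻¹) * A, by positivity, fun t ht ↦ ?_⟩
  have hΛ : ∃ t₁' : ℝ, t₁' < t ∧ HasOnlyRealZeros (deBruijnH t₁') :=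
    ⟨t₀, lt_of_lt_of_le ht₀ ht.1, hreal⟩
  have hsum := hasSum_inv_deBruijnZero_sq_add_one hΛ
  -- the uniform floor `g₀ ≤ x_1(t) ≤ x_{n+1}(t)`
  have hx1 : g₀ ≤ deBruijnZero t 1 := by
    have h := hgap t ht 0 le_rfl
    simpa using h
  have hfloor : ∀ n : ℕ, g₀ ≤ deBruijnZero t (n + 1) := fun n ↦
    hx1.trans ((strictMono_deBruijnZero hΛ).monotone (Nat.succ_le_succ (Nat.zero_le n)))
  -- termwise comparison with the Hadamard series
  have hle : ∀ n : ℕ, (deBruijnZero t (n + 1) ^ 2)⁻¹ ≤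
      (1 + (g₀ ^ 2)⁻¹) * (1 / (deBruijnZero t (n + 1) ^ 2 + 1)) := fun n ↦ by
    rw [mul_one_div]
    exact inv_sq_le_div_sq_add_one_of_le hg₀ (hfloor n)
  have hmaj : Summable fun n : ℕ ↦ (1 + (g₀ ^ 2)⁻¹) * (1 / (deBruijnZero t (n + 1) ^ 2 + 1)) :=
    hsum.summable.mul_left _
  have hs : Summable (fun n : ℕ ↦ (deBruijnZero t (n + 1) ^ 2)⁻¹) :=
    hmaj.of_nonneg_of_le (fun n ↦ by positivity) hle
  refine ⟨hs, ?_⟩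
  calc ∑' n : ℕ, (deBruijnZero t (n + 1) ^ 2)⁻¹
      ≤ ∑' n : ℕ, (1 + (g₀ ^ 2)⁻¹) * (1 / (deBruijnZero t (n + 1) ^ 2 + 1)) :=
        hs.tsum_le_tsum hle hmaj
    _ = (1 + (g₀ ^ 2)⁻¹) * (Complex.I / 2 * logDeriv (deBruijnH t) Complex.I).re := by
        rw [tsum_mul_left, hsum.tsum_eq]
    _ ≤ (1 + (g₀ ^ 2)⁻¹) * A := mul_le_mul_of_nonneg_left (hA t ht) (by positivity)

/-! ## TAILS over `ℤ` (`= ℤ*`, the index `0` contributing `0⁻¹ = 0`) -/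

/-- **Uniform TAILS bound over `ℤ`**: on `[t₁, t₂]` above a real-rooted time `t₀ < t₁` there is
`C ≥ 0` such that for every `t ∈ [t₁, t₂]` the family `j ↦ x_j(t)⁻²` on `ℤ` is summable with sum
`≤ C`; since `x_0(t) = 0` and `0⁻¹ = 0`, this is the sum over `ℤ* = ℤ ∖ {0}` of the source.
[cite: RodgersTaoFMP2020, §6 proof of Prop. 15, FMP p. 39 (the portion j > 3J or j < J/4, «using Theorem 11 and (50)»)] -/
theorem exists_tsum_inv_deBruijnZeroZ_sq_le {t₀ t₁ t₂ : ℝ}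
    (hreal : HasOnlyRealZeros (deBruijnH t₀)) (ht₀ : t₀ < t₁) :
    ∃ C : ℝ, 0 ≤ C ∧ ∀ t ∈ Icc t₁ t₂,
      Summable (fun j : ℤ ↦ (deBruijnZeroZ t j ^ 2)⁻¹) ∧
      ∑' j : ℤ, (deBruijnZeroZ t j ^ 2)⁻¹ ≤ C := by
  obtain ⟨C, hC0, hC⟩ := exists_tsum_inv_deBruijnZero_sq_le (t₂ := t₂) hreal ht₀
  refine ⟨C + C, by positivity, fun t ht ↦ ?_⟩
  obtain ⟨hs, hle⟩ := hC t ht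
  set S : ℝ := ∑' n : ℕ, (deBruijnZero t (n + 1) ^ 2)⁻¹ with hS
  set f : ℤ → ℝ := fun j ↦ (deBruijnZeroZ t j ^ 2)⁻¹ with hf
  set g : ℕ → ℝ := fun n ↦ (deBruijnZero t n ^ 2)⁻¹ with hg
  -- `Σ_{n ≥ 0} g n = S` since `g 0 = x_0⁻² = 0⁻¹ = 0`
  have hg1 : HasSum (fun n : ℕ ↦ g (n + 1)) S := hs.hasSum
  have hgS : HasSum g S := by
    have h := (hasSum_nat_add_iff 1).1 hg1
    simpa [hg] using h
  -- the non-negative and the non-positive indices each contribute `S`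
  have hnat : HasSum (fun n : ℕ ↦ f n) S :=
    hgS.congr_fun fun n ↦ by simp [hf, hg, deBruijnZeroZ_natCast]
  have hneg : HasSum (fun n : ℕ ↦ f (-(n : ℤ))) S :=
    hgS.congr_fun fun n ↦ by simp [hf, hg, deBruijnZeroZ_natCast]
  have hf0 : f 0 = 0 := by simp [hf]
  have hZ : HasSum f (S + S - f 0) := HasSum.of_nat_of_neg hnat hneg
  rw [hf0, sub_zero] at hZ
  refine ⟨hZ.summable, ?_⟩
  rw [hZ.tsum_eq]
  exact add_le_add hle hle

/-- **Uniform TAILS bound over any index set `s ⊆ ℤ`** (e.g. `ℤ* ∖ K`): with `C` as in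
`exists_tsum_inv_deBruijnZeroZ_sq_le`, the subfamily `j ∈ s ↦ x_j(t)⁻²` is summable with sum `≤ C`
for every `t ∈ [t₁, t₂]`.
[cite: RodgersTaoFMP2020, §6 proof of Prop. 15, FMP p. 39 (the portion j > 3J or j < J/4, «using Theorem 11 and (50)»)] -/
theorem exists_tsum_subtype_inv_deBruijnZeroZ_sq_le {t₀ t₁ t₂ : ℝ}
    (hreal : HasOnlyRealZeros (deBruijnH t₀)) (ht₀ : t₀ < t₁) :
    ∃ C : ℝ, 0 ≤ C ∧ ∀ t ∈ Icc t₁ t₂, ∀ s : Set ℤ,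
      Summable (fun j : s ↦ (deBruijnZeroZ t j ^ 2)⁻¹) ∧
      ∑' j : s, (deBruijnZeroZ t j ^ 2)⁻¹ ≤ C := by
  obtain ⟨C, hC0, hC⟩ := exists_tsum_inv_deBruijnZeroZ_sq_le (t₂ := t₂) hreal ht₀
  refine ⟨C, hC0, fun t ht s ↦ ?_⟩
  obtain ⟨hs, hle⟩ := hC t ht
  refine ⟨hs.subtype s, (Summable.tsum_subtype_le (fun j : ℤ ↦ (deBruijnZeroZ t j ^ 2)⁻¹) s
    (fun j ↦ by positivity) hs).trans hle⟩

/-! ## FAR FIELD per `k` (S4b′): the far part of the environment energy of one zero is `O(1)` -/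

/-- **FAR FIELD per `k` is `O(1)`** (rt-t4's frozen S4b′ signature; the RH-free content of «the
contribution of those `j` far from `K` … can be easily handled using Theorem 11 and (50)», FMP p. 39,
in the E13-repaired route): on `[t₁, t₂]` above a real-rooted time, given the location law H2
(eq. (50)) uniformly on `[t₁, t₂]`, there are `C ≥ 0` and `D ≥ 1` such that for every
`t ∈ [t₁, t₂]`, all `2 ≤ k ≤ M` and every `L ≥ D log₊² M`, any finite sum of `E_{jk}(t)` over
indices `j ∈ ℤ*` at index distance `≥ L` from `k` is `≤ C`. Route: t2's pointwise far-field bounds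
`interactionEnergy_far_right` / `_far_left` (p442229 §A; `E_{jk} ≪ (log₊² k + log₊² i)/i²`,
`i = |j − k| ≥ L`, so that `Σ_{i ≥ L} log₊² M/i² ≤ 2 log₊² M/L ≤ 2/D`) and, for the negative indices,
`sum_interactionEnergy_neg_le` with the uniform floor `x_2 − x_1 ≥ g₀` (`exists_uniform_gap_lower`).
[cite: RodgersTaoFMP2020, §6 proof of Prop. 15, FMP p. 39 («using Theorem 11 and (50)»)] -/
theorem exists_far_interactionEnergy_sum_le {t₀ t₁ t₂ B : ℝ}
    (hreal : HasOnlyRealZeros (deBruijnH t₀)) (ht₀ : t₀ < t₁)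
    (H2 : ∀ t ∈ Icc t₁ t₂, ∀ n : ℕ, 1 ≤ n →
      |deBruijnZero t n - classicalLocation (n : ℝ)| ≤ B * logPlus (classicalLocation (n : ℝ))) :
    ∃ C D : ℝ, 0 ≤ C ∧ 1 ≤ D ∧ ∀ t ∈ Icc t₁ t₂, ∀ (M L : ℕ) (k : ℤ), 2 ≤ k → k ≤ M →
      D * logPlus (M : ℝ) ^ 2 ≤ L → ∀ S : Finset ℤ, (∀ j ∈ S, j ≠ 0 ∧ (L : ℤ) ≤ |k - j|) →
        ∑ j ∈ S, interactionEnergy t j k ≤ C := by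
  classical
  -- constants: Lemma 8 (i′), (ii), the series `Σ log₊² n/n²`, the uniform floor of `x_2 − x_1`
  obtain ⟨c₁, C₁, hc₁, hc₁C₁, h8⟩ := lemma8_i_order
  obtain ⟨c₂, hc₂, hii⟩ := lemma8_ii_pos
  obtain ⟨S₀, hS₀0, hS₀⟩ := exists_sum_logPlus_sq_div_sq_le
  obtain ⟨g₀, hg₀, hgap⟩ := exists_uniform_gap_lower (t₂ := t₂) ht₀ hreal 1
  have hC₁ : 0 < C₁ := hc₁.trans_le hc₁C₁
  have hord : ∀ y : ℝ, 1 ≤ y → logPlus (classicalLocation y) ≤ C₁ * logPlus y :=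
    fun y hy ↦ (h8 y hy).2.2.2
  have hordl : ∀ y : ℝ, 1 ≤ y → c₁ * (y / logPlus y) ≤ classicalLocation y :=
    fun y hy ↦ (h8 y hy).1
  set B' : ℝ := max B 0 with hB'
  have hB'0 : 0 ≤ B' := le_max_right _ _
  set D' : ℝ := 16 * B' * C₁ ^ 2 / c₂ with hD'
  have hD'0 : 0 ≤ D' := by rw [hD']; positivity
  set c₃ : ℝ := 32 * C₁ ^ 2 / c₂ ^ 2 with hc₃
  have hc₃0 : 0 ≤ c₃ := by rw [hc₃]; positivity
  set D : ℝ := 3 * (1 + 2 * D' + 4096 * D' ^ 2) with hD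
  have hD1 : 1 ≤ D := by
    have : 0 ≤ D' ^ 2 := sq_nonneg _
    rw [hD]; linarith
  set Cneg : ℝ := (⌈1296 * B' ^ 4⌉₊ : ℝ) / g₀ ^ 2 + 4 / c₁ ^ 2 * S₀ with hCneg
  have hCneg0 : 0 ≤ Cneg := by rw [hCneg]; positivity
  refine ⟨(2 * c₃ + c₃ * S₀) + 2 * c₃ + Cneg, D, by positivity, hD1,
    fun t ht M L k hk2 hkM hL S hS ↦ ?_⟩
  -- at time `t`: `t > Λ`, the location law over `ℤ` with `B' ≥ 0`
  have hΛ : ∃ t₁' : ℝ, t₁' < t ∧ HasOnlyRealZeros (deBruijnH t₁') :=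
    ⟨t₀, lt_of_lt_of_le ht₀ ht.1, hreal⟩
  have h50 : ∀ j : ℤ, 1 ≤ j →
      |deBruijnZeroZ t j - classicalLocation (j : ℝ)| ≤ B' * logPlus (classicalLocation (j : ℝ)) := by
    intro j hj
    refine location_int_of_nat (fun n hn ↦ (H2 t ht n hn).trans ?_) hj
    exact mul_le_mul_of_nonneg_right (le_max_left _ _) (logPlus_nonneg _)
  -- the thresholds carried by `L ≥ D log₊² M`
  set P : ℝ := logPlus (M : ℝ) ^ 2 with hP
  have hP3 : 1 / 3 ≤ P := by
    have h1 : Real.log 2 ≤ logPlus (M : ℝ) := log_two_le_logPlus _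
    have h2 := Real.log_two_gt_d9
    have h3 : (0.6931471803 : ℝ) ≤ logPlus (M : ℝ) := h2.le.trans h1
    have h4 : (0.6931471803 : ℝ) * 0.6931471803 ≤ logPlus (M : ℝ) * logPlus (M : ℝ) :=
      mul_le_mul h3 h3 (by norm_num) (by linarith)
    rw [hP, sq]
    linarith
  have hP0 : 0 ≤ P := by rw [hP]; positivity
  have hDP : D * P = 3 * P + 6 * (D' * P) + 12288 * (D' ^ 2 * P) := by rw [hD]; ring
  have hD'P : 0 ≤ D' * P := mul_nonneg hD'0 hP0
  have hD'2P : 0 ≤ D' ^ 2 * P := mul_nonneg (sq_nonneg _) hP0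
  have hD'2P' : D' ^ 2 ≤ 3 * (D' ^ 2 * P) := by
    have := mul_le_mul_of_nonneg_left hP3 (sq_nonneg D')
    linarith
  have hL1R : (1 : ℝ) ≤ L := by linarith
  have hL1 : 1 ≤ L := by exact_mod_cast hL1R
  have hlogkM : logPlus (k : ℝ) ≤ logPlus (M : ℝ) := by
    refine logPlus_mono ?_
    rw [abs_of_nonneg (by exact_mod_cast (by omega : (0 : ℤ) ≤ k)),
      abs_of_nonneg (Nat.cast_nonneg M)]
    exact_mod_cast hkM
  have hlogk2 : logPlus (k : ℝ) ^ 2 ≤ P :=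
    pow_le_pow_left₀ (logPlus_nonneg _) hlogkM 2
  have hLD : 2 * D' * logPlus (k : ℝ) ^ 2 ≤ L := by
    have : 2 * D' * logPlus (k : ℝ) ^ 2 ≤ 2 * (D' * P) := by
      have := mul_le_mul_of_nonneg_left hlogk2 hD'0
      linarith
    linarith
  have hLD' : 4096 * D' ^ 2 ≤ (L : ℝ) := by linarith
  have hLM : P ≤ L := by linarith
  have hL0 : (0 : ℝ) < L := by linarith
  -- numeric tail `Σ_{i ∈ T} 1/i² ≤ 2/L` for finite `T ⊆ [L, ∞)` (Mathlib's `sum_Ioo_inv_sq_le`;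
  -- the same bookkeeping as `MoebiusWalshResonance.sum_inv_sq_tail_le`, kept local here)
  have htailsum : ∀ T : Finset ℕ, (∀ i ∈ T, L ≤ i) → ∑ i ∈ T, ((i : ℝ) ^ 2)⁻¹ ≤ 2 / L := by
    intro T hT
    have hsub : T ⊆ Finset.Ioo (L - 1) (T.sup id + 1) := by
      intro i hi
      rw [Finset.mem_Ioo]
      refine ⟨by have := hT i hi; omega, Nat.lt_succ_of_le ?_⟩
      exact Finset.le_sup (f := id) hi
    have h1 : ∑ i ∈ T, ((i : ℝ) ^ 2)⁻¹ ≤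
        ∑ i ∈ Finset.Ioo (L - 1) (T.sup id + 1), ((i : ℝ) ^ 2)⁻¹ :=
      Finset.sum_le_sum_of_subset_of_nonneg hsub fun i _ _ ↦ by positivity
    have h2 := sum_Ioo_inv_sq_le (α := ℝ) (L - 1) (T.sup id + 1)
    have h3 : ((L - 1 : ℕ) : ℝ) + 1 = L := by
      rw [Nat.cast_sub hL1]; push_cast; ring
    rw [h3] at h2
    exact h1.trans h2
  have htail : P * (2 / (L : ℝ)) ≤ 2 := by
    rw [mul_div_assoc', div_le_iff₀ hL0]; linarith
  have hc₃tail : c₃ * P * (2 / (L : ℝ)) ≤ 2 * c₃ := by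
    rw [mul_assoc]
    have := mul_le_mul_of_nonneg_left htail hc₃0
    linarith
  -- split the index set: `j > k`, `1 ≤ j < k`, `j ≤ −1`
  have hRIGHT : ∑ j ∈ S.filter (fun j ↦ k < j), interactionEnergy t j k ≤ 2 * c₃ + c₃ * S₀ := by
    -- RIGHT: `j = k + i`, `i ≥ L`
    set SR := S.filter (fun j ↦ k < j) with hSR
    set φ : ℤ → ℕ := fun j ↦ (j - k).toNat with hφ
    have hmem : ∀ j ∈ SR, k < j ∧ (L : ℤ) ≤ j - k := by
      intro j hj
      rw [hSR, Finset.mem_filter] at hj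
      have h := (hS j hj.1).2
      rw [abs_of_nonpos (by omega)] at h
      exact ⟨hj.2, by omega⟩
    have hφj : ∀ j ∈ SR, ((φ j : ℕ) : ℤ) = j - k := fun j hj ↦ by
      rw [hφ]; exact Int.toNat_of_nonneg (by have := (hmem j hj).1; omega)
    have hterm : ∀ j ∈ SR, interactionEnergy t j k ≤
        c₃ * P * (((φ j : ℕ) : ℝ) ^ 2)⁻¹ +
          c₃ * (logPlus ((φ j : ℕ) : ℝ) ^ 2 / (((φ j : ℕ) : ℝ)) ^ 2) := by
      intro j hj
      obtain ⟨hkj, hLj⟩ := hmem j hj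
      have hi : ((φ j : ℕ) : ℤ) = j - k := hφj j hj
      have hiL : L ≤ φ j := by omega
      have hi1 : 1 ≤ φ j := hL1.trans hiL
      have hiR : (L : ℝ) ≤ ((φ j : ℕ) : ℝ) := by exact_mod_cast hiL
      have hjk : j = k + ((φ j : ℕ) : ℤ) := by omega
      have h := interactionEnergy_far_right hΛ hB'0 h50 hC₁ hord hc₂ hii (k := k) (b := k)
        (by omega) le_rfl hi1 (hLD.trans hiR) (hLD'.trans hiR)
      rw [← hjk] at h
      have h' : interactionEnergy t j k ≤
          c₃ * ((logPlus (k : ℝ) ^ 2 + logPlus ((φ j : ℕ) : ℝ) ^ 2) / ((φ j : ℕ) : ℝ) ^ 2) := by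
        rw [hc₃]; exact h
      refine h'.trans ?_
      have hi0 : (0 : ℝ) < ((φ j : ℕ) : ℝ) := by exact_mod_cast hi1
      have e : c₃ * ((logPlus (k : ℝ) ^ 2 + logPlus ((φ j : ℕ) : ℝ) ^ 2) / ((φ j : ℕ) : ℝ) ^ 2) =
          c₃ * logPlus (k : ℝ) ^ 2 * ((((φ j : ℕ) : ℝ)) ^ 2)⁻¹ +
            c₃ * (logPlus ((φ j : ℕ) : ℝ) ^ 2 / (((φ j : ℕ) : ℝ)) ^ 2) := by
        rw [add_div, mul_add, div_eq_mul_inv (logPlus (k : ℝ) ^ 2), mul_assoc]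
      rw [e]
      exact add_le_add (mul_le_mul_of_nonneg_right
        (mul_le_mul_of_nonneg_left hlogk2 hc₃0) (inv_nonneg.2 (sq_nonneg _))) le_rfl
    have hinj : Set.InjOn φ SR := by
      intro j hj j' hj' h
      have h1 := hφj j hj
      have h2 := hφj j' hj'
      have : ((φ j : ℕ) : ℤ) = ((φ j' : ℕ) : ℤ) := by rw [h]
      omega
    have hT : ∀ i ∈ SR.image φ, L ≤ i := by
      intro i hi
      obtain ⟨j, hj, rfl⟩ := Finset.mem_image.1 hi
      have := hφj j hj
      have := (hmem j hj).2
      omega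
    calc ∑ j ∈ SR, interactionEnergy t j k
        ≤ ∑ j ∈ SR, (c₃ * P * (((φ j : ℕ) : ℝ) ^ 2)⁻¹ +
            c₃ * (logPlus ((φ j : ℕ) : ℝ) ^ 2 / (((φ j : ℕ) : ℝ)) ^ 2)) := Finset.sum_le_sum hterm
      _ = c₃ * P * ∑ i ∈ SR.image φ, ((i : ℝ) ^ 2)⁻¹ +
            c₃ * ∑ i ∈ SR.image φ, logPlus (i : ℝ) ^ 2 / (i : ℝ) ^ 2 := by
          rw [Finset.sum_add_distrib, ← Finset.mul_sum, ← Finset.mul_sum,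
            Finset.sum_image hinj, Finset.sum_image hinj]
      _ ≤ c₃ * P * (2 / (L : ℝ)) + c₃ * S₀ :=
          add_le_add (mul_le_mul_of_nonneg_left (htailsum _ hT)
            (mul_nonneg hc₃0 hP0)) (mul_le_mul_of_nonneg_left (hS₀ _) hc₃0)
      _ ≤ 2 * c₃ + c₃ * S₀ := by linarith
  have hLEFT : ∑ j ∈ (S.filter fun j ↦ ¬ k < j).filter (fun j ↦ 0 < j),
      interactionEnergy t j k ≤ 2 * c₃ := by
    -- LEFT (positive): `j = k − i ≥ 1`, `i ≥ L`
    set SL := (S.filter fun j ↦ ¬ k < j).filter (fun j ↦ 0 < j) with hSL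
    set φ : ℤ → ℕ := fun j ↦ (k - j).toNat with hφ
    have hmem : ∀ j ∈ SL, 0 < j ∧ j < k ∧ (L : ℤ) ≤ k - j := by
      intro j hj
      rw [hSL, Finset.mem_filter, Finset.mem_filter] at hj
      have h := (hS j hj.1.1).2
      have hle : j ≤ k := not_lt.1 hj.1.2
      rw [abs_of_nonneg (by omega)] at h
      have hL1Z : (1 : ℤ) ≤ L := by exact_mod_cast hL1
      exact ⟨hj.2, by omega, h⟩
    have hφj : ∀ j ∈ SL, ((φ j : ℕ) : ℤ) = k - j := fun j hj ↦ by
      rw [hφ]; exact Int.toNat_of_nonneg (by have := (hmem j hj).2.1; omega)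
    have hterm : ∀ j ∈ SL, interactionEnergy t j k ≤
        c₃ * P * (((φ j : ℕ) : ℝ) ^ 2)⁻¹ := by
      intro j hj
      obtain ⟨hj0, hjk, hLj⟩ := hmem j hj
      have hi : ((φ j : ℕ) : ℤ) = k - j := hφj j hj
      have hiL : L ≤ φ j := by omega
      have hi1 : 1 ≤ φ j := hL1.trans hiL
      have hiR : (L : ℝ) ≤ ((φ j : ℕ) : ℝ) := by exact_mod_cast hiL
      have hjk' : j = k - ((φ j : ℕ) : ℤ) := by omega
      have h := interactionEnergy_far_left hΛ hB'0 h50 hC₁ hord hc₂ hii (k := k) (a := k) (b := k)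
        le_rfl le_rfl hi1 (by omega) (hLD.trans hiR)
      rw [← hjk'] at h
      have h' : interactionEnergy t j k ≤ c₃ * (logPlus (k : ℝ) ^ 2 / ((φ j : ℕ) : ℝ) ^ 2) := by
        rw [hc₃]; exact h
      refine h'.trans ?_
      rw [div_eq_mul_inv, ← mul_assoc]
      exact mul_le_mul_of_nonneg_right (mul_le_mul_of_nonneg_left hlogk2 hc₃0)
        (inv_nonneg.2 (sq_nonneg _))
    have hinj : Set.InjOn φ SL := by
      intro j hj j' hj' h
      have h1 := hφj j hj
      have h2 := hφj j' hj'
      have : ((φ j : ℕ) : ℤ) = ((φ j' : ℕ) : ℤ) := by rw [h]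
      omega
    have hT : ∀ i ∈ SL.image φ, L ≤ i := by
      intro i hi
      obtain ⟨j, hj, rfl⟩ := Finset.mem_image.1 hi
      have := hφj j hj
      have := (hmem j hj).2.2
      omega
    calc ∑ j ∈ SL, interactionEnergy t j k
        ≤ ∑ j ∈ SL, c₃ * P * (((φ j : ℕ) : ℝ) ^ 2)⁻¹ := Finset.sum_le_sum hterm
      _ = c₃ * P * ∑ i ∈ SL.image φ, ((i : ℝ) ^ 2)⁻¹ := by
          rw [← Finset.mul_sum, Finset.sum_image hinj]
      _ ≤ c₃ * P * (2 / (L : ℝ)) :=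
          mul_le_mul_of_nonneg_left (htailsum _ hT) (mul_nonneg hc₃0 hP0)
      _ ≤ 2 * c₃ := hc₃tail
  have hNEG : ∑ j ∈ (S.filter fun j ↦ ¬ k < j).filter (fun j ↦ ¬ 0 < j),
      interactionEnergy t j k ≤ Cneg := by
    -- NEGATIVE: `j = −(i+1)`, all of them, via the uniform floor `x_2 − x_1 ≥ g₀`
    set SN := (S.filter fun j ↦ ¬ k < j).filter (fun j ↦ ¬ 0 < j) with hSN
    set ψ : ℤ → ℕ := fun j ↦ (-j - 1).toNat with hψ
    have hmem : ∀ j ∈ SN, j < 0 := by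
      intro j hj
      rw [hSN, Finset.mem_filter, Finset.mem_filter] at hj
      have h := (hS j hj.1.1).1
      have := not_lt.1 hj.2
      omega
    have hψj : ∀ j ∈ SN, ((ψ j : ℕ) : ℤ) = -j - 1 := fun j hj ↦ by
      rw [hψ]; exact Int.toNat_of_nonneg (by have := hmem j hj; omega)
    have hinj : Set.InjOn ψ SN := by
      intro j hj j' hj' h
      have h1 := hψj j hj
      have h2 := hψj j' hj'
      have : ((ψ j : ℕ) : ℤ) = ((ψ j' : ℕ) : ℤ) := by rw [h]
      omega
    have hmL : g₀ ≤ deBruijnZeroZ t 2 - deBruijnZeroZ t (2 - 1) := by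
      have h := hgap t ht 1 le_rfl
      have e2 : deBruijnZeroZ t 2 = deBruijnZero t 2 := by exact_mod_cast deBruijnZeroZ_natCast t 2
      have e1 : deBruijnZeroZ t (2 - 1) = deBruijnZero t 1 := by
        norm_num
        exact_mod_cast deBruijnZeroZ_natCast t 1
      rw [e2, e1]
      simpa using h
    set T := SN.image ψ with hTdef
    have hE : ∑ j ∈ SN, interactionEnergy t j k =
        ∑ i ∈ T, interactionEnergy t (-((i : ℤ) + 1)) k := by
      rw [hTdef, Finset.sum_image hinj]
      refine Finset.sum_congr rfl fun j hj ↦ ?_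
      have := hψj j hj
      congr 1
      omega
    rw [hE]
    calc ∑ i ∈ T, interactionEnergy t (-((i : ℤ) + 1)) k
        ≤ ∑ i ∈ Finset.range (T.sup id + 1), interactionEnergy t (-((i : ℤ) + 1)) k := by
          refine Finset.sum_le_sum_of_subset_of_nonneg (fun i hi ↦ ?_)
            fun i _ _ ↦ interactionEnergy_nonneg _ _ _
          exact Finset.mem_range.2 (Nat.lt_succ_of_le (Finset.le_sup (f := id) hi))
      _ ≤ Cneg := sum_interactionEnergy_neg_le hΛ hB'0 h50 hc₁ hordl hS₀ (k := k) (a := 2)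
            le_rfl hk2 hg₀ hmL _
  rw [← Finset.sum_filter_add_sum_filter_not S (fun j ↦ k < j),
    ← Finset.sum_filter_add_sum_filter_not (S.filter fun j ↦ ¬ k < j) (fun j ↦ 0 < j)]
  linarith

end Literature.NumberTheory.LFunctions

end
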